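import Mathlib
import Literature.NumberTheory.LFunctions.Zhang2022.RepairBarrierAssembly
import Literature.NumberTheory.LFunctions.Zhang2022.RepairAdmissible
import Literature.NumberTheory.LFunctions.Zhang2022.RepairPrintedFiberBridge
import Literature.NumberTheory.LFunctions.Zhang2022.RepairPrintedFiberCert
import Literature.NumberTheory.LFunctions.Zhang2022.RepairHermLeaf
import HarnessLib

/-!
# Zhang (2022) §18-margin repair rung: the `CoverCertified` structure INSTANTIATED on the printed
# `ι`-fibre — the local-annex frame (`le_C232T_of_cover`) exercised end to end

Topic `Literature/NumberTheory/LFunctions/Zhang2022` (Landau–Siegel audit tree; verdict-neutral).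
Y. Zhang, *Discrete mean estimates and the Landau–Siegel zero*, arXiv:2211.02515v1 (2022)
[Zhang2022LandauSiegel] — **an unrefereed manuscript under adjudication; nothing in this file asserts or
denies its Theorems 1–2, and nothing here is a claim about Landau–Siegel zeros.**

`RepairBarrierAssembly` §2 (the LOCAL ANNEX of the repair rung) proves floors of the θ-generic main-order
functional `C232T` on a parameter class from a `CoverCertified` package: a `FormEntries` record `E` whose
Hermitian blocks FEED the two evaluations (`E.Feeds`) and whose (18.1)-coefficients MATCH the θ-generic
closed forms (`E.MatchesReduced`, for ALL `θ`), plus a kd-cover of the class whose leaves pass the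
interval PSD test (`CoverCertified Adm coords (E.Q m₀)`) ⇒ `le_C232T_of_cover : ∀ θ ∈ Adm, m₀ ≤ C232T θ …`.
No instance of `CoverCertified` was ever landed (the cover proper was superseded by the structural
Cauchy–Schwarz verdict `Repair.not_repairable_true_need`; the width-0 regression `RepairRegressionWidth0`
runs `posSemidef_of_coverCheck` directly and bypasses the structure). This file lands ONE honest
instance, on the sub-class where a PSD certificate is banked — the printed-exponent `ι`-fibre
`θ = thetaIota w₂ w₃ w₄` with `|Re wⱼ|, |Im wⱼ| ≤ 10` — re-using the kernel booleans `cert18all_p` of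
`Section18AllIota` (no new `decide`) and the fibre regressions `F20T_thetaIota`, … of `RepairSection18Forms`:

* `Theta.coordsFull` / `Theta.ofCoordsFull` — the FULL real coordinate map (13 reals: `ν₁, ν₂, ν₃, k₁, k₂,
  k₃, cut₁, Re ι₂, Im ι₂, Re ι₃, Im ι₃, Re ι₄, Im ι₄`) and its inverse, `Theta.ofCoordsFull_coordsFull`
  (needed because `MatchesReduced` quantifies over ALL `θ`: the entries must be functions of coordinates
  that determine `θ`);
* `printedEntries : FormEntries` — the printed Hermitian-block constants `c₁₁, c₁₂, c₂₂, c₃₃, c₃₄` and the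
  θ-generic reduced coefficients `F₂₀T, F₂₁T, F₃₀T, F₃₁T ∘ ofCoordsFull`; `printedEntries_feeds` (the fed
  evaluations are `Section18AllIota.frakc1G θ.ι₂`, `frakc2G θ.ι₃ θ.ι₄`), `printedEntries_matchesReduced`;
* `PrintedFibre` (the bounded printed `ι`-fibre), `printedFibre_theta0`, `fibreBox` (one root box, 13
  rational intervals), `fibreCover` (one PSD leaf `⟨QLitP, VQP⟩`), `fibreCover_check`;
* **`coverCertified_printedFibre : CoverCertified PrintedFibre Theta.coordsFull (printedEntries.Q (3095/100000))`**
  and the frame's consumer APPLIED: `le_C232T_printedFibre_of_cover` (`0.03095 ≤ C232T θ (𝔠₁(ι₂)) (𝔠₂(ι₃,ι₄))`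
  on the fibre) and `le_C232T_theta0_of_cover` — REPRODUCING `Repair.C232T_thetaIota_ge` /
  `Section18AllIota.C232G_ge` through the `CoverCertified` path (a regression: same floor, no new content).
* (rev 2) the UNREDUCED form (`𝔠₃` of `Margin232T` = reduced + residuals `R₃T, R₄T`): `printedEntriesU`
  (`F₂₀T + R₃T`, `F₃₀T + R₄T`), `printedEntriesU_feeds`, `printedEntriesU_matchesUnreduced`, `fibreCoverU` (leaf =
  `RepairPrintedFiberCert.certS_p`'s `⟨QLitSP, VSP⟩`), `coverCertified_printedFibre_unreduced`, and the frame's two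
  remaining consumers APPLIED: `le_margin232LHS_printedFibre_of_cover` (`0.0305 + 2·10⁻⁵ ≤ margin232LHS`) and
  `not_margin232T_printedFibre_of_cover` (`not_repairable_in_class_of_cover`) — REPRODUCING
  `RepairPrintedFiberBridge.margin232LHS_thetaIota_ge` / `not_margin232T_thetaIota` through the frame.
* (rev 3) the RUMP leaf (`RepairHermLeaf`): `printedEntriesC` (`c₃₄ᶜ`), `fibreCoverRump` (banked width-0 datum,
  `width0_rump_cert`), `fibreCoverRump_check`, `re_form_nonneg_printedFibre_of_rumpCover` (the consumer applied).

What this is NOT: a cover of any cell with a free real coordinate (that was the superseded numerics plan),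
a new floor, or any statement about the manuscript beyond the already-landed `C232G_ge`.

## References

* Y. Zhang, arXiv:2211.02515v1 (2022), §2 (2.26), (2.32); §18 (18.1)–(18.2). [cite: Zhang2022LandauSiegel, §§2, 18]
* R. E. Moore, *Interval Analysis* (1966), §4.4. [Moore1966]
* S. M. Rump, *Verification of positive definiteness*, BIT 46 (2006) 433–452. [Rump2006]
-/

noncomputable section

open Real Complex ComplexConjugate Matrix
open scoped ComplexOrder
open Literature.Analysis.ValidatedNumerics (Box KdCert HermLeaf)
open Literature.Analysis.ValidatedNumerics.Numerics
open Literature.Analysis.ValidatedNumerics.IntervalGershgorin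

namespace Literature.NumberTheory.LFunctions.Zhang2022

namespace Repair

/-! ### The full coordinate map (13 reals) and its inverse -/

/-- All of `θ` as a point of `ℕ → ℝ`: `(ν₁, ν₂, ν₃, k₁, k₂, k₃, cut₁, Re ι₂, Im ι₂, Re ι₃, Im ι₃, Re ι₄, Im ι₄)`
at indices `0 … 12` (the first seven agree with `Theta.coords`), `0` beyond. [folklore] -/
def Theta.coordsFull (θ : Theta) : ℕ → ℝ := fun i =>
  [θ.nu1, θ.nu2, θ.nu3, θ.k1, θ.k2, θ.k3, θ.cut1, θ.iota2.re, θ.iota2.im, θ.iota3.re, θ.iota3.im,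
    θ.iota4.re, θ.iota4.im].getD i 0

/-- The parameter point with given full coordinates. [folklore] -/
def Theta.ofCoordsFull (x : ℕ → ℝ) : Theta where
  nu1 := x 0
  nu2 := x 1
  nu3 := x 2
  k1 := x 3
  k2 := x 4
  k3 := x 5
  iota2 := ⟨x 7, x 8⟩
  iota3 := ⟨x 9, x 10⟩
  iota4 := ⟨x 11, x 12⟩
  cut1 := x 6

/-- `ofCoordsFull ∘ coordsFull = id`: the full coordinates (the design parameters (2.21)–(2.26) and the
cut of (12.1)) determine `θ`. [cite: Zhang2022LandauSiegel, §2 (2.21)–(2.26); §12 (12.1)] -/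
theorem Theta.ofCoordsFull_coordsFull (θ : Theta) : Theta.ofCoordsFull θ.coordsFull = θ := by
  cases θ
  simp [Theta.ofCoordsFull, Theta.coordsFull]

/-! ### The printed form entries as a `FormEntries` record -/

/-- **The printed entries**: Hermitian-block constants `c₁₁, c₁₂, c₂₂, c₃₃, c₃₄` of §8/§9 (printed `c₃₄`
reading) and the θ-generic reduced (18.1)-coefficients `F₂₀T, F₂₁T, F₃₀T, F₃₁T` read through the full
coordinates. [cite: Zhang2022LandauSiegel, §8 after (8.23); §9 after (9.7); §18 (18.1)] -/
def printedEntries : FormEntries where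
  c11F := fun _ => c11
  c12F := fun _ => c12
  c22F := fun _ => c22
  c33F := fun _ => c33
  c34F := fun _ => c34
  F20F := fun x => F20T (Theta.ofCoordsFull x)
  F21F := fun x => F21T (Theta.ofCoordsFull x)
  F30F := fun x => F30T (Theta.ofCoordsFull x)
  F31F := fun x => F31T (Theta.ofCoordsFull x)

/-- **The printed blocks FEED the `ι`-generic evaluations** `𝔠₁(ι₂) = frakc1G θ.ι₂`, `𝔠₂(ι₃, ι₄) =
frakc2G θ.ι₃ θ.ι₄` (`c₂₁ = conj c₁₂`, `c₄₃ = conj c₃₄`, `c₄₄ = c₂₂` by definition).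
[cite: Zhang2022LandauSiegel, §8 after (8.23); §9 after (9.7)] -/
theorem printedEntries_feeds :
    printedEntries.Feeds Theta.coordsFull (fun θ => frakc1G θ.iota2) (fun θ => frakc2G θ.iota3 θ.iota4) := by
  intro θ
  refine ⟨?_, ?_⟩
  · show frakc1G θ.iota2 = c11 + θ.iota2 * conj c12 + conj θ.iota2 * c12 + (Complex.normSq θ.iota2 : ℂ) * c22
    unfold frakc1G c21; ring
  · show frakc2G θ.iota3 θ.iota4 = (Complex.normSq θ.iota3 : ℂ) * c33 + θ.iota3 * conj θ.iota4 * c34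
        + θ.iota4 * conj θ.iota3 * conj c34 + (Complex.normSq θ.iota4 : ℂ) * c22
    unfold frakc2G c43 c44; ring

/-- **The (18.1)-coefficients of `printedEntries` ARE the θ-generic `F··T`** for every `θ`.
[cite: Zhang2022LandauSiegel, §18 (18.1)–(18.2)] -/
theorem printedEntries_matchesReduced : printedEntries.MatchesReduced Theta.coordsFull := by
  intro θ
  simp only [printedEntries, Theta.ofCoordsFull_coordsFull, and_self]

/-! ### The bounded printed `ι`-fibre, its root box and its one-leaf cover -/

/-- **The printed `ι`-fibre, bounded**: `θ = thetaIota w₂ w₃ w₄` (printed exponents, shifts and cut; free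
`ι`) with `|Re wⱼ|, |Im wⱼ| ≤ 10` (a box is compact; the printed `ι` of (2.26) lies well inside).
[cite: Zhang2022LandauSiegel, §2 (2.21)–(2.26)] -/
def PrintedFibre (θ : Theta) : Prop :=
  ∃ w2 w3 w4 : ℂ, θ = thetaIota w2 w3 w4 ∧ (|w2.re| ≤ 10 ∧ |w2.im| ≤ 10) ∧ (|w3.re| ≤ 10 ∧ |w3.im| ≤ 10) ∧
    (|w4.re| ≤ 10 ∧ |w4.im| ≤ 10)

/-- The printed point lies in the bounded fibre. [cite: Zhang2022LandauSiegel, §2 (2.26)] -/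
theorem printedFibre_theta0 : PrintedFibre theta0 := by
  refine ⟨iota2, iota3, iota4, thetaIota_iota.symm, ?_, ?_, ?_⟩ <;>
    simp only [iota2, iota3, iota4, Complex.sub_re, Complex.sub_im, Complex.add_re, Complex.add_im,
      Complex.mul_re, Complex.mul_im, Complex.I_re, Complex.I_im, Complex.neg_re, Complex.neg_im] <;>
    norm_num

/-- **The root box of the fibre** (13 rational intervals): the seven printed real coordinates pinned,
`Re/Im ι ∈ [−10, 10]`. [cite: Moore1966, §4.4] -/
def fibreBox : Box :=
  [(63/125, 63/125), (1/2, 1/2), (249/500, 249/500), (3/2, 3/2), (5/2, 5/2), (3/2, 3/2), (1/2, 1/2),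
    (-10, 10), (-10, 10), (-10, 10), (-10, 10), (-10, 10), (-10, 10)]

/-- The full coordinates of a fibre point lie in `fibreBox`. [cite: Moore1966, §4.4] -/
theorem coordsFull_mem_fibreBox {w2 w3 w4 : ℂ} (h2 : |w2.re| ≤ 10 ∧ |w2.im| ≤ 10)
    (h3 : |w3.re| ≤ 10 ∧ |w3.im| ≤ 10) (h4 : |w4.re| ≤ 10 ∧ |w4.im| ≤ 10) :
    fibreBox.mem (thetaIota w2 w3 w4).coordsFull := by
  obtain ⟨h2r, h2i⟩ := h2
  obtain ⟨h3r, h3i⟩ := h3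
  obtain ⟨h4r, h4i⟩ := h4
  rw [abs_le] at h2r h2i h3r h3i h4r h4i
  intro i
  match i with
  | 0 | 1 | 2 | 3 | 4 | 5 | 6 =>
    simp only [Theta.coordsFull, thetaIota, fibreBox, Box.ivl, List.getD_cons_succ, List.getD_cons_zero]
    norm_num
  | 7 | 8 | 9 | 10 | 11 | 12 =>
    simp only [Theta.coordsFull, thetaIota, fibreBox, Box.ivl, List.getD_cons_succ, List.getD_cons_zero]
    push_cast
    constructor <;> linarith
  | n + 13 =>
    simp only [Theta.coordsFull, fibreBox, Box.ivl, List.getD_cons_succ, List.getD_nil]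
    norm_num

/-- **The one-leaf cover of the fibre**: root `fibreBox`, leaf = the RECORD's literal box table `QLitP`
and integer eigenbasis `VQP` of `Section18AllIota.cert18all_p`. [cite: Rump2006, §1] -/
def fibreCover : List (Box × KdCert (Option (PsdLeaf 4))) :=
  [(fibreBox, KdCert.leaf (some ⟨QLitP, VQP⟩))]

/-- The checker accepts the cover (re-using the banked booleans of `cert18all_p`; no new `decide`).
[cite: Rump2006, §1] -/
theorem fibreCover_check :
    coverCheck (psdLeafOK (fun _ => false) (fun _ => true) (fun _ => QBox c34B (3095/100000)))
      fibreCover = true := by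
  simp [fibreCover, coverCheck, KdCert.check, psdLeafOK, cert18all_p.1, cert18all_p.2]

/-! ### The region predicate and the matrix family on it -/

/-- The region: the seven REAL coordinates are the printed ones (`ι` free). [cite: Zhang2022LandauSiegel, §2 (2.21)–(2.25)] -/
def PrintedReals (x : ℕ → ℝ) : Prop :=
  x 0 = 0.504 ∧ x 1 = 0.5 ∧ x 2 = 0.498 ∧ x 3 = 3 / 2 ∧ x 4 = 5 / 2 ∧ x 5 = 3 / 2 ∧ x 6 = 0.5

/-- On the region the reconstructed `θ` is a point of the printed `ι`-fibre. [cite: Zhang2022LandauSiegel, §2 (2.21)–(2.26)] -/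
theorem ofCoordsFull_of_printedReals {x : ℕ → ℝ} (h : PrintedReals x) :
    Theta.ofCoordsFull x = thetaIota ⟨x 7, x 8⟩ ⟨x 9, x 10⟩ ⟨x 11, x 12⟩ := by
  obtain ⟨h0, h1, h2, h3, h4, h5, h6⟩ := h
  simp only [Theta.ofCoordsFull, thetaIota, h0, h1, h2, h3, h4, h5, h6]

/-- Fibre points have printed real coordinates. [cite: Zhang2022LandauSiegel, §2 (2.21)–(2.25)] -/
theorem printedReals_coordsFull (w2 w3 w4 : ℂ) : PrintedReals (thetaIota w2 w3 w4).coordsFull := by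
  simp only [PrintedReals, Theta.coordsFull, thetaIota, List.getD_cons_succ, List.getD_cons_zero]
  norm_num

/-- **On the region the family is the record matrix**: `printedEntries.Q m x = Section18AllIota.QM c34 m`
(the `F··T` regress to the printed `F··` on the fibre: `F20T_thetaIota`, …; `QM_eq_QMOf`).
[cite: Zhang2022LandauSiegel, (2.32), §18 (18.1)] -/
theorem printedEntries_Q_of_printedReals {x : ℕ → ℝ} (h : PrintedReals x) (m : ℚ) :
    printedEntries.Q m x = QM c34 m := by
  unfold FormEntries.Q
  simp only [printedEntries, ofCoordsFull_of_printedReals h, F20T_thetaIota, F21T_thetaIota,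
    F30T_thetaIota, F31T_thetaIota]
  rfl

/-! ### The certified cover and the frame's consumer, applied -/

/-- **`CoverCertified` INSTANTIATED**: the bounded printed `ι`-fibre, the full coordinates, and the matrix
family of `printedEntries` at `m₀ = 0.03095` admit a certified cover (one root box, one PSD leaf, trivial
excluder, region = printed real coordinates). [cite: Moore1966, §4.4] -/
theorem coverCertified_printedFibre :
    CoverCertified PrintedFibre Theta.coordsFull (printedEntries.Q (3095/100000)) := by
  refine ⟨⟨PrintedReals, fun _ => false, fun _ => true, fun _ => QBox c34B (3095/100000), fibreCover,
    fibreCover_check, ?_, ?_, ?_, ?_⟩⟩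
  · intro B hB; simp at hB
  · intro B _ x _ hR
    rw [printedEntries_Q_of_printedReals hR]
    exact mem_QBox mem_c34 _
  · intro x hR
    rw [printedEntries_Q_of_printedReals hR]
    exact QM_conjTranspose _ _
  · rintro θ ⟨w2, w3, w4, rfl, h2, h3, h4⟩
    exact ⟨⟨(fibreBox, KdCert.leaf (some ⟨QLitP, VQP⟩)), by simp [fibreCover],
      coordsFull_mem_fibreBox h2 h3 h4⟩, printedReals_coordsFull w2 w3 w4⟩

/-- **The local annex APPLIED** (`le_C232T_of_cover` with `printedEntries_feeds`,
`printedEntries_matchesReduced`, `coverCertified_printedFibre`): on the bounded printed `ι`-fibre,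
`0.03095 ≤ C232T θ 𝔠₁(ι₂) 𝔠₂(ι₃,ι₄)` — the floor of `Section18AllIota.C232G_ge` / `Repair.C232T_thetaIota_ge`,
re-derived through the `CoverCertified` path (regression; no new content). [cite: Zhang2022LandauSiegel, (2.32), §18] -/
theorem le_C232T_printedFibre_of_cover :
    ∀ θ, PrintedFibre θ → (0.03095 : ℝ) ≤ C232T θ (frakc1G θ.iota2) (frakc2G θ.iota3 θ.iota4) := by
  intro θ hθ
  have h := le_C232T_of_cover printedEntries_feeds printedEntries_matchesReduced coverCertified_printedFibre
    θ hθ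
  have e : (((3095/100000 : ℚ)) : ℝ) = 0.03095 := by norm_num
  rw [e] at h
  exact h

/-- … in particular at the printed point: `0.03095 ≤ C232T θ₀ 𝔠₁(ι₂) 𝔠₂(ι₃,ι₄)` through the cover path
(`= C232T_thetaIota_ge iota2 iota3 iota4` by `thetaIota_iota`). [cite: Zhang2022LandauSiegel, (2.32), §18] -/
theorem le_C232T_theta0_of_cover :
    (0.03095 : ℝ) ≤ C232T theta0 (frakc1G iota2) (frakc2G iota3 iota4) :=
  le_C232T_printedFibre_of_cover theta0 printedFibre_theta0

/-! ### (rev 2) The UNREDUCED form: `le_margin232LHS_of_cover` / `not_repairable_in_class_of_cover` applied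

The rung's own margin functional `Margin232T` carries the unreduced `𝔠₃ = 𝔠₃ʳ + ῑ₃R₃ + ῑ₄R₄` (residuals of the
identity defect). `FormEntries.MatchesUnreduced` asks `F₂₀F = F₂₀T + R₃T`, `F₃₀F = F₃₀T + R₄T`; on the printed
fibre these regress to `F₂₀ + R₃`, `F₃₀ + R₄` (`R3T_thetaIota`, `R4T_thetaIota`), whose matrix is
`RepairPrintedFiberForms.QMS c34 R3 R4 m` (`QMS_eq_QMOf`) with the banked certificate `certS_p` at `m = 0.0305`. -/

/-- **The printed entries, unreduced (18.1)-coefficients** (`F₂₀T + R₃T`, `F₂₁T`, `F₃₀T + R₄T`, `F₃₁T` through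
the full coordinates). [cite: Zhang2022LandauSiegel, §18 (18.1), p. 99] -/
def printedEntriesU : FormEntries where
  c11F := fun _ => c11
  c12F := fun _ => c12
  c22F := fun _ => c22
  c33F := fun _ => c33
  c34F := fun _ => c34
  F20F := fun x => F20T (Theta.ofCoordsFull x) + R3T (Theta.ofCoordsFull x)
  F21F := fun x => F21T (Theta.ofCoordsFull x)
  F30F := fun x => F30T (Theta.ofCoordsFull x) + R4T (Theta.ofCoordsFull x)
  F31F := fun x => F31T (Theta.ofCoordsFull x)

/-- The unreduced entries feed the same `ι`-generic evaluations `frakc1G θ.ι₂`, `frakc2G θ.ι₃ θ.ι₄`.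
[cite: Zhang2022LandauSiegel, §8 after (8.23); §9 after (9.7)] -/
theorem printedEntriesU_feeds :
    printedEntriesU.Feeds Theta.coordsFull (fun θ => frakc1G θ.iota2) (fun θ => frakc2G θ.iota3 θ.iota4) := by
  intro θ
  refine ⟨?_, ?_⟩
  · show frakc1G θ.iota2 = c11 + θ.iota2 * conj c12 + conj θ.iota2 * c12 + (Complex.normSq θ.iota2 : ℂ) * c22
    unfold frakc1G c21; ring
  · show frakc2G θ.iota3 θ.iota4 = (Complex.normSq θ.iota3 : ℂ) * c33 + θ.iota3 * conj θ.iota4 * c34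
        + θ.iota4 * conj θ.iota3 * conj c34 + (Complex.normSq θ.iota4 : ℂ) * c22
    unfold frakc2G c43 c44; ring

/-- **The unreduced coefficients MATCH `F₂₀T + R₃T, F₂₁T, F₃₀T + R₄T, F₃₁T`** for every `θ`.
[cite: Zhang2022LandauSiegel, §18 (18.1), p. 99] -/
theorem printedEntriesU_matchesUnreduced : printedEntriesU.MatchesUnreduced Theta.coordsFull := by
  intro θ
  simp only [printedEntriesU, Theta.ofCoordsFull_coordsFull, and_self]

/-- On the region the unreduced family is `QMS c34 R3 R4 m` (`F··T_thetaIota`, `R3T_thetaIota`, `R4T_thetaIota`,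
`QMS_eq_QMOf`). [cite: Zhang2022LandauSiegel, (2.32), §18 (18.1)] -/
theorem printedEntriesU_Q_of_printedReals {x : ℕ → ℝ} (h : PrintedReals x) (m : ℚ) :
    printedEntriesU.Q m x = QMS c34 R3 R4 m := by
  unfold FormEntries.Q
  simp only [printedEntriesU, ofCoordsFull_of_printedReals h, F20T_thetaIota, F21T_thetaIota,
    F30T_thetaIota, F31T_thetaIota, R3T_thetaIota, R4T_thetaIota]
  rfl

/-- The one-leaf cover for the unreduced family: leaf = `RepairPrintedFiberCert`'s `⟨QLitSP, VSP⟩`.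
[cite: Rump2006, §1] -/
def fibreCoverU : List (Box × KdCert (Option (PsdLeaf 4))) :=
  [(fibreBox, KdCert.leaf (some ⟨QLitSP, VSP⟩))]

/-- The checker accepts it (re-using `certS_p`; no new `decide`). [cite: Rump2006, §1] -/
theorem fibreCoverU_check :
    coverCheck (psdLeafOK (fun _ => false) (fun _ => true) (fun _ => QBoxS c34B R3B R4B (305/10000)))
      fibreCoverU = true := by
  simp [fibreCoverU, coverCheck, KdCert.check, psdLeafOK, certS_p.1, certS_p.2]

/-- **`CoverCertified` for the UNREDUCED family** on the bounded printed `ι`-fibre at `m₀ = 0.0305`.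
[cite: Moore1966, §4.4] -/
theorem coverCertified_printedFibre_unreduced :
    CoverCertified PrintedFibre Theta.coordsFull (printedEntriesU.Q (305/10000)) := by
  refine ⟨⟨PrintedReals, fun _ => false, fun _ => true, fun _ => QBoxS c34B R3B R4B (305/10000), fibreCoverU,
    fibreCoverU_check, ?_, ?_, ?_, ?_⟩⟩
  · intro B hB; simp at hB
  · intro B _ x _ hR
    rw [printedEntriesU_Q_of_printedReals hR]
    exact mem_QBoxS mem_c34 mem_R3 mem_R4 _
  · intro x hR
    rw [printedEntriesU_Q_of_printedReals hR]
    exact QMS_conjTranspose _ _ _ _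
  · rintro θ ⟨w2, w3, w4, rfl, h2, h3, h4⟩
    exact ⟨⟨(fibreBox, KdCert.leaf (some ⟨QLitSP, VSP⟩)), by simp [fibreCoverU],
      coordsFull_mem_fibreBox h2 h3 h4⟩, printedReals_coordsFull w2 w3 w4⟩

/-- **`le_margin232LHS_of_cover` APPLIED**: on the bounded printed `ι`-fibre, `0.0305 + 2·10⁻⁵ ≤
margin232LHS θ 𝔠₁(ι₂) 𝔠₂(ι₃,ι₄)` — `RepairPrintedFiberBridge.margin232LHS_thetaIota_ge` through the frame
(regression; no new content). [cite: Zhang2022LandauSiegel, §18 p. 99] -/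
theorem le_margin232LHS_printedFibre_of_cover :
    ∀ θ, PrintedFibre θ →
      (0.0305 : ℝ) + 2e-5 ≤ margin232LHS θ (frakc1G θ.iota2) (frakc2G θ.iota3 θ.iota4) := by
  intro θ hθ
  have h := le_margin232LHS_of_cover printedEntriesU_feeds printedEntriesU_matchesUnreduced
    coverCertified_printedFibre_unreduced θ hθ
  have e : (((305/10000 : ℚ)) : ℝ) = 0.0305 := by norm_num
  rw [e] at h
  exact h

/-- **`not_repairable_in_class_of_cover` APPLIED**: the rung's margin functional `Margin232T` fails at every
point of the bounded printed `ι`-fibre (`0.001 ≤ 0.0305 + 2·10⁻⁵`) — `not_margin232T_thetaIota` through the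
frame (regression). [cite: Zhang2022LandauSiegel, §18 p. 99] -/
theorem not_margin232T_printedFibre_of_cover :
    ∀ θ, PrintedFibre θ → ¬ Margin232T θ (frakc1G θ.iota2) (frakc2G θ.iota3 θ.iota4) :=
  not_repairable_in_class_of_cover printedEntriesU_feeds printedEntriesU_matchesUnreduced
    coverCertified_printedFibre_unreduced (by norm_num)

/-! ### (rev 3) The RUMP-type leaf (`rumpLeafOK`, banked datum `width0_rump_cert`, `c₃₄ᶜ`, `m = 0.0248`) -/

/-- The printed entries, `0.5`-prefactor reading `c₃₄ᶜ`. [cite: Zhang2022LandauSiegel, §9 (9.5)–(9.7); §18 (18.1)] -/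
def printedEntriesC : FormEntries where
  c11F := fun _ => c11
  c12F := fun _ => c12
  c22F := fun _ => c22
  c33F := fun _ => c33
  c34F := fun _ => c34c
  F20F := fun x => F20T (Theta.ofCoordsFull x)
  F21F := fun x => F21T (Theta.ofCoordsFull x)
  F30F := fun x => F30T (Theta.ofCoordsFull x)
  F31F := fun x => F31T (Theta.ofCoordsFull x)

/-- On the region the `c₃₄ᶜ` family is `QMOf … c34c … m` (= `QM c34c m`). [cite: Zhang2022LandauSiegel, (2.32), §18 (18.1)] -/
theorem printedEntriesC_Q_of_printedReals {x : ℕ → ℝ} (h : PrintedReals x) (m : ℚ) :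
    printedEntriesC.Q m x = QMOf c11 c21 c12 c22 c33 c34c F20 F21 F30 F31 m := by
  unfold FormEntries.Q
  simp only [printedEntriesC, ofCoordsFull_of_printedReals h, F20T_thetaIota, F21T_thetaIota,
    F30T_thetaIota, F31T_thetaIota]
  rfl

/-- The Rump-type one-leaf cover: root `fibreBox`, leaf = `RepairHermLeaf`'s banked width-0 datum. [cite: Rump2006, §1] -/
def fibreCoverRump : List (Box × KdCert (Option (HermLeaf Unit))) :=
  [(fibreBox, KdCert.leaf (some ⟨w0CreC, w0CimC, w0RadC, w0CertC, ()⟩))]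

/-- The Rump checker accepts the cover (re-using `width0_rump_cert`; no new `decide`). [cite: Rump2006, §1] -/
theorem fibreCoverRump_check :
    coverCheck (rumpLeafOK (fun _ => false) (fun _ => true)
      (fun _ => QBoxOf c11B c21B c12B c22B c33B c34cB F20B F21B F30B F31B (248/10000))) fibreCoverRump = true := by
  have hlam : decide ((0 : ℚ) ≤ w0CertC.lam) = true := by rw [show w0CertC.lam = 0 from rfl]; rfl
  simp [fibreCoverRump, coverCheck, KdCert.check, rumpLeafOK, width0_rump_cert.1, width0_rump_cert.2, hlam]

/-- **`re_form_nonneg_of_coverCheck` APPLIED** (Rump leaf): `Re(v* Q v) ≥ 0` on the covered printed fibre, `Q = printedEntriesC.Q 0.0248` (core of `RepairHermLeaf.C232cG_ge_via_rump`, through the frame). [cite: Rump2006, §1] -/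
theorem re_form_nonneg_printedFibre_of_rumpCover :
    ∀ x, CoverMem fibreCoverRump x → PrintedReals x →
      ∀ v : Fin 4 → ℂ, 0 ≤ (star v ⬝ᵥ (printedEntriesC.Q (248/10000) x *ᵥ v)).re :=
  re_form_nonneg_of_coverCheck (R := PrintedReals) (excl := fun _ => false) (ok := fun _ => true)
    (QB := fun _ => QBoxOf c11B c21B c12B c22B c33B c34cB F20B F21B F30B F31B (248/10000))
    (by intro B hB; simp at hB)
    (by
      intro B _ x _ hR
      rw [printedEntriesC_Q_of_printedReals hR]
      exact mem_QBoxOf mem_c11 mem_c21 mem_c12 mem_c22 mem_c33 mem_c34c mem_F20 mem_F21 mem_F30 mem_F31 _)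
    fibreCoverRump_check

end Repair
end Literature.NumberTheory.LFunctions.Zhang2022
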